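import Literature.MathematicalPhysics.KineticTheory.LambertianRedrawNondegenerate
import Literature.MathematicalPhysics.KineticTheory.HardSphereEuler
import Summits.AtomisticToContinuum.HydrodynamicLimit.Theorems.LambertianContactSwapLambertianWellPosedRegular
import HarnessLib

/-!
# Λ-Liouville invariance: from short windows to all forward times
# (`LambertianContactSwap.LambertianEuler`, stmt-AtomisticToContinuum-11854, line `Sketch`;
# sub-goal `liouvilleInvarianceLambda_of_window` of the stub `stub_liouvilleInvariance`)

The Lambertian hard-sphere flow `Λ_t(z; ξs) = lambertFlow G ε ξs z t` of
`Literature.MathematicalPhysics.KineticTheory.LambertianHardSphereFlow` is a cocycle over the noise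
shift: off the accumulation set, `Λ_{s+u}(z; ξs) = Λ_u(Λ_s(z; ξs); ξs (· + K_s))`, `K_s = lambertCount`
(`lambertFlow_add_eq_restart`, from the restart kit `LRestart.lambertFlow_add_of_segment` /
`LRestart.exists_lambert_segment` / `LRestart.lambertInstant_lambertFlow_succ_add` of
`…LambertianWellPosedRestart/Regular`).  Hence the annealed invariance
`(L ⊗ γ^ℕ) ∘ Λ_t⁻¹ = L` ITERATES (`map_lambertFlow_add_eq`): granted
* joint measurability of every `Λ_t`,
* `L ⊗ γ^ℕ`-a.e. non-accumulation of the collision instants,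
* the fresh-tail (strong Markov) identity — for fixed `z`, under `γ^ℕ` the shifted noise
  `ξs (· + K_t)` is again `γ^ℕ`-distributed and independent of `Λ_t(z; ξs)`, in the `lintegral`
  form used by the stub (a HYPOTHESIS here),
invariance at times `s` and `u` gives invariance at time `s + u`: for measurable `f ≥ 0`,
`∫ f(Λ_{s+u}) d(L ⊗ γ^ℕ) = ∫ dL(z) ∫ dγ^ℕ(ξs) f(Λ_u(Λ_s(z;ξs); shifted ξs))` (Tonelli + cocycle a.e.)
`= ∫ dL(z) ∫ dγ^ℕ(ξs) ∫ dγ^ℕ(ηs) f(Λ_u(Λ_s(z;ξs); ηs))` (fresh tail)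
`= ∫ dL(w) ∫ dγ^ℕ(ηs) f(Λ_u(w; ηs))` (invariance at `s`, `lintegral_map`) `= ∫ f dL` (invariance at
`u`).  Induction over windows of length `δ` then gives the registered sub-goal
`liouvilleInvarianceLambda_of_window` (torus `𝕋³`, `L = liouville`): invariance for all windows
`s ∈ [0, δ]` implies invariance for all `t ≥ 0`.  Pure measure theory; no hypothesis on `ε`.
All [folklore].
-/

noncomputable section

open scoped BigOperators Topology ENNReal InnerProductSpace
open MeasureTheory ProbabilityTheory Filter Set
open Literature.MathematicalPhysics.KineticTheory
open Literature.Analysis.FluidPDE Literature.Analysis.FluidPDE.Alexander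

namespace Summit.AtomisticToContinuum.HydrodynamicLimit.Theorems.LambertianContactSwapLambertianEulerLiouvilleOfWindow

variable {d : Type*} [Fintype d] {X : Type*} {N : ℕ} {G : Geometry d X} {ε : ℝ}

/-! ## The cocycle identity off the accumulation set -/

/-- Non-accumulation transfers to the restarted recursion: if `s` lies in the `k`-th collision
segment of `(z, ξs)` and some instant of `(z, ξs)` exceeds `s + u`, then some instant of the
recursion restarted at `Λ_s(z; ξs)` with the shifted noise `ξs (· + k)` exceeds `u`. [folklore] -/
theorem exists_lt_lambertInstant_restart {ξs : ℕ → EuclideanSpace ℝ d} {z : Config N d X}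
    {s u : ℝ} {k : ℕ} (hs : 0 ≤ s) (hu : 0 ≤ u)
    (h1 : lambertInstant G ε ξs z k ≤ ENNReal.ofReal s)
    (h2 : ENNReal.ofReal s < lambertInstant G ε ξs z (k + 1))
    (h3 : ∃ k', ENNReal.ofReal (s + u) < lambertInstant G ε ξs z k') :
    ∃ m, ENNReal.ofReal u <
      lambertInstant G ε (fun n => ξs (n + k)) (lambertFlow G ε ξs z s) m := by
  obtain ⟨k', hk'⟩ := h3
  have hlt : ENNReal.ofReal u + ENNReal.ofReal s <
      lambertInstant G ε (fun n => ξs (n + k)) (lambertFlow G ε ξs z s) (k' + 1) +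
        ENNReal.ofReal s := by
    rw [LRestart.lambertInstant_lambertFlow_succ_add hs h1 h2 k', ← ENNReal.ofReal_add hu hs,
      add_comm u s]
    exact hk'.trans_le (monotone_lambertInstant _ _ (by omega))
  exact ⟨k' + 1, (ENNReal.add_lt_add_iff_right ENNReal.ofReal_ne_top).1 hlt⟩

/-- **Cocycle identity of the Lambertian flow over the noise shift**, off the accumulation set:
if the collision instants of `(z, ξs)` pass beyond `s` and beyond `s + u` (`s, u ≥ 0`), then
`Λ_{s+u}(z; ξs) = Λ_u(Λ_s(z; ξs); ξs (· + K_s(z; ξs)))`, `K_s = lambertCount`. [folklore] -/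
theorem lambertFlow_add_eq_restart {ξs : ℕ → EuclideanSpace ℝ d} {z : Config N d X} {s u : ℝ}
    (hs : 0 ≤ s) (hu : 0 ≤ u)
    (hS : ∃ k, ENNReal.ofReal s < lambertInstant G ε ξs z k)
    (hSU : ∃ k, ENNReal.ofReal (s + u) < lambertInstant G ε ξs z k) :
    lambertFlow G ε ξs z (s + u) =
      lambertFlow G ε (fun n => ξs (n + lambertCount G ε ξs z s)) (lambertFlow G ε ξs z s) u := by
  obtain ⟨k, h1, h2⟩ := LRestart.exists_lambert_segment hS le_rfl
  rw [lambertCount_eq_of_segment h1 h2]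
  obtain ⟨m, h1', h2'⟩ :=
    LRestart.exists_lambert_segment (exists_lt_lambertInstant_restart hs hu h1 h2 hSU) le_rfl
  exact LRestart.lambertFlow_add_of_segment hs hu h1 h2 h1' h2'

/-! ## One iteration step of the annealed invariance -/

section Step

variable [MeasurableSpace X]

/-- **Semigroup step of the annealed invariance** (any geometry, any measure `L` on phase space):
granted joint measurability of every `Λ_t`, `L ⊗ γ^ℕ`-a.e. non-accumulation of the collision
instants and the fresh-tail identity (for fixed `z`, the noise shifted by `K_t` is again `γ^ℕ` and
independent of `Λ_t(z; ·)`, in `lintegral` form), the invariances `(L ⊗ γ^ℕ) ∘ Λ_s⁻¹ = L` and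
`(L ⊗ γ^ℕ) ∘ Λ_u⁻¹ = L` (`s, u ≥ 0`) give `(L ⊗ γ^ℕ) ∘ Λ_{s+u}⁻¹ = L`. [folklore] -/
theorem map_lambertFlow_add_eq (L : Measure (Config N d X)) {s u : ℝ} (hs : 0 ≤ s) (hu : 0 ≤ u)
    (hmeas : ∀ t : ℝ, Measurable fun p : Config N d X × (ℕ → EuclideanSpace ℝ d) =>
      lambertFlow G ε p.2 p.1 t)
    (hacc : ∀ᵐ p ∂(L.prod (lambertNoise d)),
      ∀ T : ℝ, ∃ k, ENNReal.ofReal T < lambertInstant G ε p.2 p.1 k)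
    (hfresh : ∀ {H : Config N d X × (ℕ → EuclideanSpace ℝ d) → ℝ≥0∞}, Measurable H →
      ∀ (z : Config N d X) (t : ℝ), 0 ≤ t →
        (∀ᵐ ξs ∂(lambertNoise d), ∃ k, ENNReal.ofReal t < lambertInstant G ε ξs z k) →
        ∫⁻ ξs, H (lambertFlow G ε ξs z t, fun n => ξs (n + lambertCount G ε ξs z t))
            ∂(lambertNoise d) =
          ∫⁻ ξs, (∫⁻ ηs, H (lambertFlow G ε ξs z t, ηs) ∂(lambertNoise d)) ∂(lambertNoise d))
    (hS : (L.prod (lambertNoise d)).map (fun p => lambertFlow G ε p.2 p.1 s) = L)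
    (hU : (L.prod (lambertNoise d)).map (fun p => lambertFlow G ε p.2 p.1 u) = L) :
    (L.prod (lambertNoise d)).map (fun p => lambertFlow G ε p.2 p.1 (s + u)) = L := by
  refine Measure.ext_of_lintegral _ fun f hf => ?_
  have hfu : Measurable fun q : Config N d X × (ℕ → EuclideanSpace ℝ d) =>
      f (lambertFlow G ε q.2 q.1 u) := hf.comp (hmeas u)
  have hF : Measurable fun w : Config N d X =>
      ∫⁻ ηs, f (lambertFlow G ε ηs w u) ∂(lambertNoise d) :=
    hfu.lintegral_prod_right'
  have hacc' : ∀ᵐ z ∂L, ∀ᵐ ξs ∂(lambertNoise d),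
      ∀ T : ℝ, ∃ k, ENNReal.ofReal T < lambertInstant G ε ξs z k :=
    Measure.ae_ae_of_ae_prod hacc
  calc ∫⁻ w, f w ∂(L.prod (lambertNoise d)).map (fun p => lambertFlow G ε p.2 p.1 (s + u))
      = ∫⁻ p, f (lambertFlow G ε p.2 p.1 (s + u)) ∂(L.prod (lambertNoise d)) :=
        lintegral_map hf (hmeas (s + u))
    _ = ∫⁻ z, (∫⁻ ξs, f (lambertFlow G ε ξs z (s + u)) ∂(lambertNoise d)) ∂L :=
        lintegral_prod _ (hf.comp (hmeas (s + u))).aemeasurable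
    _ = ∫⁻ z, (∫⁻ ξs, (∫⁻ ηs, f (lambertFlow G ε ηs (lambertFlow G ε ξs z s) u)
          ∂(lambertNoise d)) ∂(lambertNoise d)) ∂L := by
        refine lintegral_congr_ae (hacc'.mono fun z hz => ?_)
        have hzS : ∀ᵐ ξs ∂(lambertNoise d), ∃ k, ENNReal.ofReal s < lambertInstant G ε ξs z k :=
          hz.mono fun ξs h => h s
        have key : ∫⁻ ξs, f (lambertFlow G ε (fun n => ξs (n + lambertCount G ε ξs z s))
              (lambertFlow G ε ξs z s) u) ∂(lambertNoise d) =
            ∫⁻ ξs, (∫⁻ ηs, f (lambertFlow G ε ηs (lambertFlow G ε ξs z s) u)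
              ∂(lambertNoise d)) ∂(lambertNoise d) :=
          hfresh hfu z s hs hzS
        refine Eq.trans ?_ key
        refine lintegral_congr_ae (hz.mono fun ξs h => ?_)
        show f (lambertFlow G ε ξs z (s + u)) = f (lambertFlow G ε
          (fun n => ξs (n + lambertCount G ε ξs z s)) (lambertFlow G ε ξs z s) u)
        rw [lambertFlow_add_eq_restart (ξs := ξs) (z := z) hs hu (h s) (h (s + u))]
    _ = ∫⁻ p, (∫⁻ ηs, f (lambertFlow G ε ηs (lambertFlow G ε p.2 p.1 s) u) ∂(lambertNoise d))
          ∂(L.prod (lambertNoise d)) :=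
        (lintegral_prod _ (hF.comp (hmeas s)).aemeasurable).symm
    _ = ∫⁻ w, (∫⁻ ηs, f (lambertFlow G ε ηs w u) ∂(lambertNoise d))
          ∂(L.prod (lambertNoise d)).map (fun p => lambertFlow G ε p.2 p.1 s) :=
        (lintegral_map hF (hmeas s)).symm
    _ = ∫⁻ w, (∫⁻ ηs, f (lambertFlow G ε ηs w u) ∂(lambertNoise d)) ∂L := by rw [hS]
    _ = ∫⁻ p, f (lambertFlow G ε p.2 p.1 u) ∂(L.prod (lambertNoise d)) :=
        (lintegral_prod _ hfu.aemeasurable).symm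
    _ = ∫⁻ w, f w ∂(L.prod (lambertNoise d)).map (fun p => lambertFlow G ε p.2 p.1 u) :=
        (lintegral_map hf (hmeas u)).symm
    _ = ∫⁻ w, f w ∂L := by rw [hU]

/-- **Iteration over windows** (any geometry, any measure `L` on phase space): under the three
standing hypotheses of `map_lambertFlow_add_eq`, invariance `(L ⊗ γ^ℕ) ∘ Λ_s⁻¹ = L` for all windows
`s ∈ [0, δ]`, `δ > 0`, implies invariance for every `t ≥ 0` (induction on `⌈t/δ⌉`). [folklore] -/
theorem map_lambertFlow_eq_of_window (L : Measure (Config N d X)) {δ : ℝ} (hδ : 0 < δ)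
    (hmeas : ∀ t : ℝ, Measurable fun p : Config N d X × (ℕ → EuclideanSpace ℝ d) =>
      lambertFlow G ε p.2 p.1 t)
    (hacc : ∀ᵐ p ∂(L.prod (lambertNoise d)),
      ∀ T : ℝ, ∃ k, ENNReal.ofReal T < lambertInstant G ε p.2 p.1 k)
    (hfresh : ∀ {H : Config N d X × (ℕ → EuclideanSpace ℝ d) → ℝ≥0∞}, Measurable H →
      ∀ (z : Config N d X) (t : ℝ), 0 ≤ t →
        (∀ᵐ ξs ∂(lambertNoise d), ∃ k, ENNReal.ofReal t < lambertInstant G ε ξs z k) →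
        ∫⁻ ξs, H (lambertFlow G ε ξs z t, fun n => ξs (n + lambertCount G ε ξs z t))
            ∂(lambertNoise d) =
          ∫⁻ ξs, (∫⁻ ηs, H (lambertFlow G ε ξs z t, ηs) ∂(lambertNoise d)) ∂(lambertNoise d))
    (hwin : ∀ s : ℝ, 0 ≤ s → s ≤ δ →
      (L.prod (lambertNoise d)).map (fun p => lambertFlow G ε p.2 p.1 s) = L)
    {t : ℝ} (ht : 0 ≤ t) :
    (L.prod (lambertNoise d)).map (fun p => lambertFlow G ε p.2 p.1 t) = L := by
  -- invariance on `[0, (n + 1) δ]` by induction on `n`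
  have key : ∀ (n : ℕ) (t : ℝ), 0 ≤ t → t ≤ (n + 1) * δ →
      (L.prod (lambertNoise d)).map (fun p => lambertFlow G ε p.2 p.1 t) = L := by
    intro n
    induction n with
    | zero =>
      intro t ht htδ
      exact hwin t ht (by simpa using htδ)
    | succ n ih =>
      intro t ht htδ
      by_cases hle : t ≤ (n + 1) * δ
      · exact ih t ht hle
      · have hlt : (n + 1) * δ < t := not_le.1 hle
        have hn0 : (0 : ℝ) ≤ n * δ := mul_nonneg (Nat.cast_nonneg n) hδ.le
        have hs0 : 0 ≤ t - δ := by linarith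
        have hsle : t - δ ≤ (n + 1) * δ := by push_cast at htδ; linarith
        have h := map_lambertFlow_add_eq L hs0 hδ.le hmeas hacc hfresh (ih (t - δ) hs0 hsle)
          (hwin δ hδ.le le_rfl)
        rwa [sub_add_cancel] at h
  obtain ⟨n, hn⟩ := exists_nat_ge (t / δ)
  refine key n t ht ?_
  have h' : t / δ ≤ n + 1 := hn.trans (by linarith)
  rwa [div_le_iff₀ hδ] at h'

end Step

/-! ## The registered sub-goal -/

/-- **Sub-goal `liouvilleInvarianceLambda_of_window` of `stub_liouvilleInvariance`** (line `Sketch`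
of the crux `LambertianContactSwap.LambertianEuler`; hard spheres of diameter `ε` on `𝕋³`, `N`
spheres, Liouville measure `liouville`, Lambertian noise `γ^ℕ = lambertNoise`): granted (h1) joint
measurability of every `Λ_s`, (h2) `liouville ⊗ γ^ℕ`-a.e. non-accumulation of the collision instants,
(h3) the fresh-tail (strong Markov) identity and (h4) the annealed invariance
`(liouville ⊗ γ^ℕ) ∘ Λ_s⁻¹ = liouville` for all windows `s ∈ [0, δ]` (`δ > 0`), the annealed
invariance holds for every `t ≥ 0`. The ITERATION step of the Λ-Liouville theorem; pure measure
theory (`map_lambertFlow_eq_of_window`). [folklore] -/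
theorem liouvilleInvarianceLambda_of_window :
    ∀ (N : ℕ) (ε δ : ℝ), 0 < δ →
    (∀ s : ℝ, Measurable fun p : Config N (Fin 3) T3 × (ℕ → V3) =>
      lambertFlow (Torus.geometry (Fin 3)) ε p.2 p.1 s) →
    (∀ᵐ p ∂((liouville (Torus.geometry (Fin 3)) N ε).prod (lambertNoise (Fin 3))),
      ∀ T : ℝ, ∃ k, ENNReal.ofReal T < lambertInstant (Torus.geometry (Fin 3)) ε p.2 p.1 k) →
    (∀ {H : Config N (Fin 3) T3 × (ℕ → V3) → ℝ≥0∞}, Measurable H →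
      ∀ (z : Config N (Fin 3) T3) (t : ℝ), 0 ≤ t →
        (∀ᵐ ξs ∂(lambertNoise (Fin 3)), ∃ k,
          ENNReal.ofReal t < lambertInstant (Torus.geometry (Fin 3)) ε ξs z k) →
        ∫⁻ ξs, H (lambertFlow (Torus.geometry (Fin 3)) ε ξs z t,
            fun n => ξs (n + lambertCount (Torus.geometry (Fin 3)) ε ξs z t)) ∂(lambertNoise (Fin 3)) =
          ∫⁻ ξs, (∫⁻ ηs, H (lambertFlow (Torus.geometry (Fin 3)) ε ξs z t, ηs) ∂(lambertNoise (Fin 3)))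
            ∂(lambertNoise (Fin 3))) →
    (∀ s : ℝ, 0 ≤ s → s ≤ δ →
      ((liouville (Torus.geometry (Fin 3)) N ε).prod (lambertNoise (Fin 3))).map
          (fun p => lambertFlow (Torus.geometry (Fin 3)) ε p.2 p.1 s) =
        liouville (Torus.geometry (Fin 3)) N ε) →
    ∀ t : ℝ, 0 ≤ t →
      ((liouville (Torus.geometry (Fin 3)) N ε).prod (lambertNoise (Fin 3))).map
          (fun p => lambertFlow (Torus.geometry (Fin 3)) ε p.2 p.1 t) =
        liouville (Torus.geometry (Fin 3)) N ε :=
  fun N ε _ hδ hmeas hacc hfresh hwin _ ht =>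
    map_lambertFlow_eq_of_window (liouville (Torus.geometry (Fin 3)) N ε) hδ hmeas hacc hfresh hwin ht

end Summit.AtomisticToContinuum.HydrodynamicLimit.Theorems.LambertianContactSwapLambertianEulerLiouvilleOfWindow

end
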